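import Summits.Parity.GeneralizedHardyLittlewood.Theorems.LeeYangFibresAbsoluteUpgradeNlcReduction
import Summits.Parity.GeneralizedHardyLittlewood.Theorems.LeeYangFibresAbsoluteUpgradeDipReduction
import Summits.Parity.GeneralizedHardyLittlewood.Theorems.LeeYangFibresAbsoluteUpgradeCellsOfDimOne
import Summits.Parity.GeneralizedHardyLittlewood.Theorems.LeeYangFibresAbsoluteUpgradeSlices
import Summits.Parity.GeneralizedHardyLittlewood.Theses.DicksonFibration
import HarnessLib

/-!
# Route `LeeYangFibres`, crux `AbsoluteUpgrade` (stmt-Parity-14116): the crux against the shared target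

`AbsoluteUpgrade := RelativeDimOne → DimOne`.  After four line-lead seats every provable stub of both
mechanism lines is landed and both reductions are UNGUARDED (`dimOne_of_nlcInputs`, p119763;
`DipMarginRateExchange.dimOne_of_dipInputs`, p114853), and the cell-level node both lines deliver is
the target (`primeCellsAbsolute_iff_dimOne`, p120846).  This file records, as theorems of the tree and
BY NAME against the HOME declaration `Theses.DicksonFibration.DimOne` of the shared target item
stmt-Parity-0819 (wanted by eight `d = 1` routes; the route's own `LeeYangFibres.DimOne` is a verbatim
copy, `dimOne_iff_target`), the exact logical position of the crux:

* `absoluteUpgrade_and_relativeDimOne_iff_target` : `(AbsoluteUpgrade ∧ RelativeDimOne) ↔ DicksonFibration.DimOne`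
  — what the route's deciding theorem `closes hR hU hF := hF (hU hR)` consumes is the target itself;
* `absoluteUpgrade_iff_target_or` : `AbsoluteUpgrade ↔ (DicksonFibration.DimOne ∨ ¬ RelativeDimOne)` and
  `not_absoluteUpgrade_iff_target` : `¬ AbsoluteUpgrade ↔ (RelativeDimOne ∧ ¬ DicksonFibration.DimOne)`
  — the crux is decided exactly when the target is decided on the `RelativeDimOne` branch, and a
  refutation needs `RelativeDimOne` (twin primes) first;
* `target_iff_relativeDimOne_and_highMass` : the target splits as the route's output node
  `RelativeDimOne` plus the high-mass residual of `absoluteUpgrade_iff_highMass` (p77305) — the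
  `t ≥ 2` systems of singular mass `≥ M N` (primorial-type shifts), where relative `o(1)` misses
  absolute `ε N` by the factor `∏_p β_p ≍ (log log N)^{t-1}`;
* `target_of_nlcInputs`, `target_of_dipInputs` : the residual stub pair of EACH line implies the target
  outright, so promoting either pair re-files stmt-Parity-0819;
* `absoluteUpgrade_of_target` : the one-line discharge of the crux the day stmt-Parity-0819 lands.

Nothing here is conjectural and nothing is asserted about primes: the content is the bookkeeping that
makes "stmt-Parity-14116 is held on stmt-Parity-0819" a kernel-checked statement rather than a note.

References: Green–Tao 2010, Conj. 1.2 (absolute, `DimOne`) vs Conj. 1.4 (relative + absolute,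
`RelativeDimOne`) [GreenTao2010]; Gallagher 1976 (singular series on average — averages, never the sup
the residual needs) [Gallagher1976]; Matomäki–Merikoski 2023, Thm 1.3 (Siegel sensitivity of both sides)
[MatomakiMerikoski2023].
-/

noncomputable section

namespace Summit.Parity.GeneralizedHardyLittlewood.Theorems.AbsoluteUpgrade

open Literature.NumberTheory.Sieve
open Summit.Parity.GeneralizedHardyLittlewood.Theses.LeeYangFibres
open Summit.Parity.GeneralizedHardyLittlewood.Theorems.LeeYangFibresRelativeDimOne (relativeDimOne_of_dimOne)
open Summit.Parity.GeneralizedHardyLittlewood.Cruxes.AbsoluteUpgrade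

/-- The route's copy `LeeYangFibres.DimOne` of the target is the shared item's home declaration
`DicksonFibration.DimOne` (stmt-Parity-0819) verbatim. [cite: GreenTao2010, Conj. 1.2] -/
theorem dimOne_iff_target : DimOne ↔ Theses.DicksonFibration.DimOne := Iff.rfl

/-- **Discharge by the target.** The day stmt-Parity-0819 is proved (through any route's copy), the crux
`AbsoluteUpgrade := RelativeDimOne → DimOne` closes by this one-liner. [folklore] -/
theorem absoluteUpgrade_of_target (h : Theses.DicksonFibration.DimOne) : AbsoluteUpgrade := fun _ => h

/-- The crux and the route's output node together are the target (modus ponens). [folklore] -/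
theorem target_of_absoluteUpgrade (hU : AbsoluteUpgrade) (hR : RelativeDimOne) :
    Theses.DicksonFibration.DimOne :=
  hU hR

/-- **What `closes` consumes is the target.** `(AbsoluteUpgrade ∧ RelativeDimOne) ↔ DicksonFibration.DimOne`;
`←` uses `DimOne → RelativeDimOne` (`relativeDimOne_of_dimOne`: the relative + absolute error of
Green–Tao Conj. 1.4 is implied by the absolute one). [cite: GreenTao2010, Conj. 1.4] -/
theorem absoluteUpgrade_and_relativeDimOne_iff_target :
    (AbsoluteUpgrade ∧ RelativeDimOne) ↔ Summit.Parity.GeneralizedHardyLittlewood.Theses.DicksonFibration.DimOne :=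
  ⟨fun h => h.1 h.2, fun h => ⟨fun _ => h, relativeDimOne_of_dimOne h⟩⟩

/-- **Logical position of the crux.** `AbsoluteUpgrade` holds iff the target holds or the route's output
node fails: it is decided exactly when stmt-Parity-0819 is decided on the `RelativeDimOne` branch.
[folklore] -/
theorem absoluteUpgrade_iff_target_or :
    AbsoluteUpgrade ↔ (Theses.DicksonFibration.DimOne ∨ ¬ RelativeDimOne) := by
  constructor
  · intro hU
    by_cases hR : RelativeDimOne
    · exact Or.inl (hU hR)
    · exact Or.inr hR
  · rintro (hD | hR)
    · exact fun _ => hD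
    · exact fun h => absurd h hR

/-- … equivalently, a refutation of the crux is a proof of `RelativeDimOne` (hence of the twin prime
conjecture, `twinPrimeConjecture_of_relativeDimOne`) together with a refutation of the target.
[folklore] -/
theorem not_absoluteUpgrade_iff_target :
    ¬ AbsoluteUpgrade ↔ (RelativeDimOne ∧ ¬ Theses.DicksonFibration.DimOne) := by
  rw [absoluteUpgrade_iff_target_or, not_or, not_not, and_comm]

/-- **The target splits as output node + high-mass residual.** `DicksonFibration.DimOne` holds iff
`RelativeDimOne` holds and, for every `t ≥ 2`, `L`, `ε > 0`, some mass threshold `M` makes the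
ABSOLUTE bound `ε N` hold eventually on all admissible `(Ψ, K)` of singular mass
`archFactor Ψ K * singularProduct Ψ ≥ M N` — the family (primorial-type shifts,
`∏_p β_p ≍ (log log N)^{t-1}`, inhabited by `Theorems/LeeYangFibresAbsoluteUpgradeHighMass`) on which
relative accuracy misses absolute accuracy.  `absoluteUpgrade_iff_highMass` (p77305) run through
`absoluteUpgrade_and_relativeDimOne_iff_target`. [cite: GreenTao2010, Conj. 1.2] -/
theorem target_iff_relativeDimOne_and_highMass :
    Theses.DicksonFibration.DimOne ↔ (RelativeDimOne ∧ ∀ (t L : ℕ), 2 ≤ t → ∀ ε : ℝ, 0 < ε →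
      ∃ M : ℝ, 0 ≤ M ∧ ∃ N₀ : ℕ, ∀ N : ℕ, N₀ ≤ N → ∀ Ψ : Fin t → AffLinForm 1,
        IsNondegenerateSystem Ψ → affLinSize Ψ N ≤ L → ∀ K : Set (Fin 1 → ℝ), Convex ℝ K →
          K ⊆ realBox 1 N → M * N ≤ archFactor Ψ K * singularProduct Ψ →
            |vonMangoldtSum Ψ K N - archFactor Ψ K * singularProduct Ψ| ≤ ε * (N : ℝ)) := by
  constructor
  · intro hD
    have hR : RelativeDimOne := relativeDimOne_of_dimOne hD
    exact ⟨hR, absoluteUpgrade_iff_highMass.mp (fun _ => hD) hR⟩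
  · rintro ⟨hR, hhigh⟩
    exact absoluteUpgrade_iff_highMass.mpr (fun _ => hhigh) hR

/-- **Line `nlc-cells-absolute-clip`: its residual stub pair implies the target outright** (the
`RelativeDimOne` guard of `stub_cellParityLawLog3` / `stub_cellNLC` is inert): `dimOne_of_nlcInputs`
(p119763) read against the home declaration. [cite: GreenTao2010, Conj. 1.2] -/
theorem target_of_nlcInputs (hlaw : NlcCellsAbsoluteClip.CellParityLawLog3)
    (hnlc : NlcCellsAbsoluteClip.CellNLC) : Theses.DicksonFibration.DimOne :=
  dimOne_of_nlcInputs hlaw hnlc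

/-- **Line `dip-margin-rate-exchange`: its residual stub pair implies the target outright** (the guard
of `stub_cellParityLawSaving` / `stub_fibreHyperbolicityAlong` is inert):
`DipMarginRateExchange.dimOne_of_dipInputs` (p114853) read against the home declaration.
[cite: GreenTao2010, Conj. 1.2] -/
theorem target_of_dipInputs (hL : DipMarginRateExchange.CellParityLawSaving)
    (hF : DipMarginRateExchange.FibreHyperbolicityAlong) : Theses.DicksonFibration.DimOne :=
  DipMarginRateExchange.dimOne_of_dipInputs hL hF

/-- **Both lines meet the target at the same cell-level node**: the absolute prime corner cell
`PrimeCellsAbsolute` of the nlc vocabulary is the target (`primeCellsAbsolute_iff_dimOne`, p120846),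
so "promote the shared node" re-files stmt-Parity-0819. [cite: GreenTao2010, (1.8)] -/
theorem primeCellsAbsolute_iff_target :
    NlcCellsAbsoluteClip.PrimeCellsAbsolute ↔ Theses.DicksonFibration.DimOne :=
  primeCellsAbsolute_iff_dimOne

end Summit.Parity.GeneralizedHardyLittlewood.Theorems.AbsoluteUpgrade

end
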